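import Summits.QuantumFields.YangMills.Theorems.EquipartitionCriticalityLatticeGapLargeBetaStubSlabToCrux

/-!
# Stub `stub_slabToCruxFrom` of line `Sketch` (card `af-staircase-transport`) for crux stmt-QuantumFields-8761
(`Summit.QuantumFields.YangMills.Theses.EquipartitionCriticality.LatticeGapLargeBeta`)

The `β₁`-threshold version of `stub_slabToCrux`: if from some threshold `β₁` on all bounded
gauge-invariant local observables cluster on all large tori `(2S+1)⁴` with constants seeing `A, B`
only through sup norms `a, b` and the time width `w` of the supports (`m(β) ∈ (0, 1]`, `K(β) ≥ 2`,
`S₀(β)`), and rate dilution holds, then the crux body holds for `r` with that same threshold `β₁`,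
the diluted rate `m(β) log 2 / log K(β) > 0`, the same `S₀(β)` and the `β`-UNIFORM constant
`C(A, B) = 2 e^{2w+1} a b`.
-/

noncomputable section

open scoped BigOperators Topology
open MeasureTheory ProbabilityTheory Filter
open Literature.MathematicalPhysics.QuantumFieldTheory Literature.MathematicalPhysics.QuantumLattice

namespace Summit.QuantumFields.YangMills.Theorems.LatticeGapLargeBeta.AfStaircase

/-- `stub_slabToCruxFrom` — **from the SC currency (above a threshold) to the crux body** (T).  If
for every `β ≥ β₁` all species cluster on all large tori in the SC currency with some
`m(β) ∈ (0, 1]`, `K(β) ≥ 2`, `S₀(β)`, and rate dilution holds (shape of `stub_rateDilution`), then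
the crux body holds for `r` with the same threshold `β₁`, the diluted rate
`m(β) log 2 / log K(β) > 0`, the same `S₀(β)`, and the `β`-UNIFORM constant
`C(A,B) = 2 e^{2w+1} a b` (`a, b` sup bounds from `A.bounded`, `B.bounded`, `w` the time width of
`A.supp ∪ B.supp`); the a priori bound is `abs_latticeConnectedCorr_le_two_mul`. -/
theorem stub_slabToCruxFrom :
    ∀ (G : Type) [Group G] [TopologicalSpace G] [IsTopologicalGroup G] [CompactSpace G]
      [MeasurableSpace G] [BorelSpace G] (r : LatticeRep G),
    (∃ β₁ : ℝ, ∀ β : ℝ, β₁ ≤ β → ∃ (m K : ℝ) (S₀ : ℕ), 0 < m ∧ m ≤ 1 ∧ 2 ≤ K ∧ ∀ S : ℕ, S₀ ≤ S →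
      ∀ (A B : YMSpecies G) (a b : ℝ) (w : ℕ), (∀ U, |A.F U| ≤ a) → (∀ U, |B.F U| ≤ b) →
        (∀ e ∈ A.supp, |e.1 0| ≤ (w : ℤ)) → (∀ e ∈ B.supp, |e.1 0| ≤ (w : ℤ)) →
        ∀ n : ℕ, n ≤ S →
          |latticeConnectedCorr r.ρ β (2 * S + 1) A.F B.F n| ≤
            K * a * b * Real.exp (m * (2 * w)) * Real.exp (-(m * n))) →
    (∀ (c : ℕ → ℝ) (a b K m : ℝ) (w S : ℕ), 0 ≤ a → 0 ≤ b → 2 ≤ K → 0 < m → m ≤ 1 →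
      (∀ n : ℕ, n ≤ S → |c n| ≤ 2 * a * b) →
      (∀ n : ℕ, n ≤ S → |c n| ≤ K * a * b * Real.exp (m * (2 * w)) * Real.exp (-(m * n))) →
      ∀ n : ℕ, n ≤ S →
        |c n| ≤ 2 * Real.exp (2 * w + 1) * a * b * Real.exp (-(m * Real.log 2 / Real.log K * n))) →
    ∃ (β₁ : ℝ) (m : ℝ → ℝ) (S₀ : ℝ → ℕ), (∀ β : ℝ, β₁ ≤ β → 0 < m β) ∧
      ∀ A B : YMSpecies G, ∃ C : ℝ, ∀ β : ℝ, β₁ ≤ β → ∀ S n : ℕ, S₀ β ≤ S → n ≤ S →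
        |latticeConnectedCorr r.ρ β (2 * S + 1) A.F B.F n| ≤ C * Real.exp (-(m β * n)) := by
  intro G _ _ _ _ _ _ r hSC hRD
  obtain ⟨β₁, hSC⟩ := hSC
  choose! m K S₀ hm hm1 hK hP using hSC
  refine ⟨β₁, fun β => m β * Real.log 2 / Real.log (K β), S₀, fun β hβ => ?_, fun A B => ?_⟩
  · -- positivity of the diluted rate: `m β > 0`, `log 2 > 0`, `log (K β) > 0` since `K β ≥ 2 > 1`
    exact div_pos (mul_pos (hm β hβ) (Real.log_pos one_lt_two))
      (Real.log_pos (lt_of_lt_of_le one_lt_two (hK β hβ)))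
  · obtain ⟨a, ha⟩ := A.bounded
    obtain ⟨b, hb⟩ := B.bounded
    have ha0 : 0 ≤ a := (abs_nonneg _).trans (ha fun _ => 1)
    have hb0 : 0 ≤ b := (abs_nonneg _).trans (hb fun _ => 1)
    -- the time width of `A.supp ∪ B.supp`
    obtain ⟨w, hwA, hwB⟩ : ∃ w : ℕ, (∀ e ∈ A.supp, |e.1 0| ≤ (w : ℤ)) ∧
        ∀ e ∈ B.supp, |e.1 0| ≤ (w : ℤ) :=
      ⟨(A.supp ∪ B.supp).sup fun e => (e.1 0).natAbs,
        fun e he => abs_le_natCast_sup_natAbs (fun e => e.1 0) (Finset.mem_union_left B.supp he),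
        fun e he => abs_le_natCast_sup_natAbs (fun e => e.1 0) (Finset.mem_union_right A.supp he)⟩
    refine ⟨2 * Real.exp (2 * w + 1) * a * b, fun β hβ S n hS hn => ?_⟩
    exact hRD (fun k => latticeConnectedCorr r.ρ β (2 * S + 1) A.F B.F k) a b (K β) (m β) w S
      ha0 hb0 (hK β hβ) (hm β hβ) (hm1 β hβ)
      (fun k _ => by
        rw [mul_assoc]
        exact WilsonBlockHeatBath.abs_latticeConnectedCorr_le_two_mul r β (2 * S + 1) ha hb k)
      (fun k hk => hP β hβ S hS A B a b w ha hb hwA hwB k hk) n hn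

end Summit.QuantumFields.YangMills.Theorems.LatticeGapLargeBeta.AfStaircase

end
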